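import Summits.BirchSwinnertonDyer.Rank1Residual.GaloisImage.SelmerClassInertia
import Literature.NumberTheory.GaloisRepresentations.CoinducedDiscreteGaloisModule
import Literature.NumberTheory.GaloisRepresentations.ContinuousShapiroLiftCores
import Literature.NumberTheory.EllipticCurves.SubgroupSelmerCocycleCriteriaProofs
import Literature.NumberTheory.EllipticCurves.GreenbergSelmer
import Literature.NumberTheory.EllipticCurves.HeegnerModuleIndex
import Literature.NumberTheory.EllipticCurves.GeomPointsGaloisModule
import HarnessLib

/-!
# Route `ThetaPartnerAtTwo` (TP2), crux K2R0P♭ `SignedMainConjectureCMTwoRankZeroOfPubOfFlat` (stmt-BirchSwinnertonDyer-26471;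
# derived node K2r0P 24945), line `rankzero` v20, stub `stub_poitouTateDeepTwo` = (S_PT), hypothesis (E) `hE` — bricks (E1b)/(E1c):
# **SHAPIRO TRANSPORT OF LOCAL TRIVIALITY** (if the localisation at a place `w` — finite or infinite — of the Shapiro lift `Sh c` of a
# layer class `c ∈ H¹(Γ_n, M)` VANISHES, then every conjugate `conj_σ c` dies on `Γ_n ∩ D_w`)

HONEST FRAMING (cell `pub/bsd-wall`, W-ALL row 1; extra width seat `bsd-wall-tp2-p2-w4` g0, bricks (E1b)/(E1c) as assigned on the bus by
`tp2-p2-w3` g3, 2026-08-28T11:58Z — the `[bad]`/`[inf]` inputs of w2's transfer (T) displayed as `hE1b`/`hE1c` in w3's (E2) socket;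
`--supports` only). THEOREMS ONLY (no definition, no named fact, no instance, no `sorry`); closes no item; BSD is NOT proved by any of this.

## What is proved

Let `K` be a number field, `ρ : Γ_K → Aut(M)` a discrete Galois module, `N ⊴ Γ_K` an open NORMAL subgroup of finite index with coset
representatives `s` (`s(1·N) = 1`), `F = Sh f` the Shapiro cocycle (`shapiroCocycle`) of a continuous crossed homomorphism `f : N → M`.

* §1 `exists_apply_conj_eq_of_shapiroCocycle_eq_on` (pure group cohomology, any topological group): if `F` is a coboundary ON A
  SUBGROUP `D` — `F(g) = g ⋆ Φ₀ − Φ₀` for `g ∈ D` — then for every `σ ∈ G` there is `a ∈ M` with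
  **`σ • f(k) = (σkσ⁻¹) • a − a` for every `k ∈ N` with `σkσ⁻¹ ∈ D`**, explicitly `a = Φ₀(σN) − σ • f(σ⁻¹ s(σN))`: evaluate
  `F(x) = x ⋆ Φ₀ − Φ₀` (`x = σkσ⁻¹ ∈ D ∩ N` fixes the coset `σN`) at the coset `σN`, where `F(x)(σN) = s(σN) • f(s(σN)⁻¹ x s(σN))`, and
  `s(σN) = σ n₀`, `n₀ ∈ N` (inner conjugation by `n₀` is absorbed by the cocycle identity). This is the «all conjugates at once» content of
  the Shapiro lift: its value at the coset `σN` is the `σ`-conjugate of `f`.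
* §2 `exists_apply_conj_eq_of_res_shapiroLift_eq_zero`: for a field `E ⊇ K` (a completion), if the restriction to `Γ_E` of
  `Sh c ∈ H¹(Γ_K, Maps(Γ_K ⧸ N, M))` (`galoisCohomology.res (ρ.coind N hN) E 1`, i.e. the LOCALISATION when `E = K_w`) vanishes, §1 applies
  with `D = D_w :=` the image of `Γ_E → Γ_K` (`GreenbergSelmer.decomp` / `decompInf`).
* §3 the `hE`-currency corollaries for `M = E[m]` (`W.torsionGaloisModule m`, classes `c : W.torsionH1Over m (κ.layerSubgroup n)` at a layer
  of a `ℤ_p`-extension), in the `awayKer`/`infKer` language of `GreenbergSelmer.selmerGroupOver`: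
  **(E1b)** `resOfLe_decomp_conjH1_eq_zero_of_localization_shapiroLift_eq_zero`: `loc_w (Sh c) = 0` at a FINITE place `w` ⟹
  `∀ σ, resOfLe (geomTorsion W m) (inf_le_left : κ.layerSubgroup n ⊓ decomp w ≤ κ.layerSubgroup n) (conjH1 (κ.layerSubgroup n) _ σ c) = 0`;
  **(E1c)** `resOfLe_decompInf_conjH1_eq_zero_of_localization_shapiroLift_eq_zero`: the same at an INFINITE place `w` (`Sum.inl w`,
  `decompInf w`).

References: [NeukirchSchmidtWingberg2008] I §5 (1.5.6)–(1.5.7), I §6 Prop. (1.6.4); [Brown1982] III §5 (5.6)(b) (Mackey); [SerreGaloisCohomology1997]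
I §2.5 (conjugation on `H¹`); [Greenberg1989] §1 p. 98 (3) (the local conditions at `v ∤ p` and at `∞`).
-/

set_option autoImplicit false
-- the Theorems namespace of this sub repeats the summit name by design (D-0017 nested layout)
set_option linter.dupNamespace false

noncomputable section

open scoped Classical NumberField Pointwise

universe u v

namespace Summit.BirchSwinnertonDyer.BirchSwinnertonDyer.Theorems

namespace SignedLowerOffTwo.PTDeep

open CategoryTheory Field NumberField IsDedekindDomain
  Literature.NumberTheory.GaloisRepresentations Literature.NumberTheory.GaloisRepresentations.DiscreteGaloisModule
  Literature.NumberTheory.EllipticCurves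

/-! ## §1 The Shapiro cocycle at the coset `σN` is the `σ`-conjugate of `f` -/

section Core

variable {R : Type u} [CommRing R] [TopologicalSpace R]
  {G : Type v} [Group G] [TopologicalSpace G] [IsTopologicalGroup G]
  (X : TopRep.{v} R G) (N : Subgroup G) [N.Normal] (hN : IsOpen (N : Set G))
  {s : G ⧸ N → G} (hs : ∀ x : G ⧸ N, (s x : G ⧸ N) = x)

/-- **If the Shapiro cocycle `F = Sh f` is a coboundary on a subgroup `D` (`F(g) = g ⋆ Φ₀ − Φ₀`, `g ∈ D`), then every conjugate of `f`
is a coboundary on `N ∩ σ⁻¹Dσ`:** for every `σ` there is `a` with `σ • f(k) = (σkσ⁻¹) • a − a` whenever `k ∈ N`, `σkσ⁻¹ ∈ D`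
(namely `a = Φ₀(σN) − σ • f(σ⁻¹ s(σN))`). [cite: NeukirchSchmidtWingberg2008, I §6 Prop. (1.6.4)] [cite: Brown1982, III §5 (5.6)(b)] -/
theorem exists_apply_conj_eq_of_shapiroCocycle_eq_on (f : contOneCocycles (subgroupRep X N)) {D : Subgroup G}
    {Φ₀ : coindFin X N} (hΦ : ∀ g ∈ D, (shapiroCocycle X N hN hs f).1 g = (coindFin X N).ρ g Φ₀ - Φ₀) (σ : G) :
    ∃ a : X, ∀ k : N, σ * (k : G) * σ⁻¹ ∈ D → X.ρ σ (f.1 k) = X.ρ (σ * (k : G) * σ⁻¹) a - a := by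
  -- the coset `y = σN`, its representative `t = s y = σ n₀`
  set y : G ⧸ N := (σ : G ⧸ N) with hy
  set t : G := s y with ht
  have hn₀ : σ⁻¹ * t ∈ N := QuotientGroup.eq.mp (hs y).symm
  set n₀ : N := ⟨σ⁻¹ * t, hn₀⟩ with hn₀def
  have hσn₀ : σ * (n₀ : G) = t := mul_inv_cancel_left σ t
  have hρ : ∀ (n : N) (v : X), (subgroupRep X N).ρ n v = X.ρ (n : G) v := fun _ _ ↦ rfl
  -- `f(n₀⁻¹) = − n₀⁻¹ • f(n₀)`
  have hinv : f.1 n₀⁻¹ = -(X.ρ ((n₀ : G)⁻¹) (f.1 n₀)) := by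
    have h := f.2 n₀⁻¹ n₀
    rw [inv_mul_cancel, contOneCocycles.apply_one, hρ, Subgroup.coe_inv] at h
    exact (neg_eq_of_add_eq_zero_left h.symm).symm
  refine ⟨Φ₀ y - X.ρ σ (f.1 n₀), fun k hk ↦ ?_⟩
  -- `x = σ k σ⁻¹ ∈ D ∩ N` fixes the coset `y`
  set x : G := σ * (k : G) * σ⁻¹ with hx
  have hxN : x ∈ N := Subgroup.Normal.conj_mem inferInstance (k : G) k.2 σ
  have hxy : x⁻¹ • y = y := by
    rw [hy, MulAction.Quotient.smul_coe, smul_eq_mul, QuotientGroup.eq]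
    have e : (x⁻¹ * σ)⁻¹ * σ = (k : G) := by rw [hx]; group
    rw [e]; exact k.2
  have hxy' : x • y = y := by
    conv_lhs => rw [← hxy]
    rw [smul_inv_smul]
  -- evaluate `F(x) = x ⋆ Φ₀ − Φ₀` at the coset `y`
  have h1 : (shapiroCocycle X N hN hs f).1 x y = ((coindFin X N).ρ x Φ₀ - Φ₀) y := by rw [hΦ x hk]
  rw [shapiroCocycle_apply, hxy, coindFin_sub_apply, coindFin_ρ_apply, hxy] at h1
  -- the Schreier element at `y` is `n₀⁻¹ k n₀`
  have hsch : schreierElt N hs x y = n₀⁻¹ * k * n₀ := by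
    apply Subtype.ext
    rw [schreierElt_coe, hxy', Subgroup.coe_mul, Subgroup.coe_mul, Subgroup.coe_inv, ← ht, hx]
    change _ = (σ⁻¹ * t)⁻¹ * (k : G) * (σ⁻¹ * t)
    group
  rw [hsch, ← ht] at h1
  -- expand `f(n₀⁻¹ k n₀)` with the cocycle identity
  have h2 : f.1 (n₀⁻¹ * k * n₀) = X.ρ ((n₀ : G)⁻¹) (f.1 k + X.ρ (k : G) (f.1 n₀) - f.1 n₀) := by
    rw [f.2 (n₀⁻¹ * k) n₀, f.2 n₀⁻¹ k, hinv, hρ, hρ, Subgroup.coe_mul, Subgroup.coe_inv, ρ_mul_apply, map_sub, map_add]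
    abel
  rw [h2, ← ρ_mul_apply, ← hσn₀, mul_assoc, mul_inv_cancel, mul_one, map_sub, map_add, ← ρ_mul_apply] at h1
  -- `σ k = x σ`
  have hσk : σ * (k : G) = x * σ := by rw [hx]; group
  rw [hσk, ρ_mul_apply] at h1
  -- `h1 : σ•f k + x•σ•f n₀ − σ•f n₀ = x•Φ₀ y − Φ₀ y`
  rw [map_sub]
  calc X.ρ σ (f.1 k)
      = (X.ρ x (Φ₀ y) - Φ₀ y) - (X.ρ x (X.ρ σ (f.1 n₀)) - X.ρ σ (f.1 n₀)) := by rw [← h1]; abel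
    _ = X.ρ x (Φ₀ y) - X.ρ x (X.ρ σ (f.1 n₀)) - (Φ₀ y - X.ρ σ (f.1 n₀)) := by abel

end Core

/-! ## §2 From the vanishing of the restriction of `Sh c` to `Γ_E` -/

section Res

variable {K : Type u} [Field K] [NumberField K] {M : Type u} [AddCommGroup M] [TopologicalSpace M] [DiscreteTopology M]
  (ρ : DiscreteGaloisModule K M) (N : Subgroup (absoluteGaloisGroup K)) [N.Normal] [Fintype (absoluteGaloisGroup K ⧸ N)]
  (hN : IsOpen (N : Set (absoluteGaloisGroup K))) {s : absoluteGaloisGroup K ⧸ N → absoluteGaloisGroup K}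
  (hs : ∀ x : absoluteGaloisGroup K ⧸ N, (s x : absoluteGaloisGroup K ⧸ N) = x)
  (hs1 : s ((1 : absoluteGaloisGroup K) : absoluteGaloisGroup K ⧸ N) = 1)
  (E : Type u) [Field E] [Algebra K E]

omit [NumberField K] in
/-- **If the restriction to `Γ_E` of the Shapiro lift `Sh [f]` vanishes** (`galoisCohomology.res (ρ.coind N hN) E 1`; for `E = K_w` this is the
localisation at `w`), then for every `σ ∈ Γ_K` there is `a ∈ M` with `σ • f(k) = (σkσ⁻¹) • a − a` for all `k ∈ N` with `σkσ⁻¹` in the image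
`D_E` of `Γ_E → Γ_K`. [cite: NeukirchSchmidtWingberg2008, I §6 Prop. (1.6.4)] [cite: SerreGaloisCohomology1997, I §2.5] -/
theorem exists_apply_conj_eq_of_res_shapiroLift_eq_zero (f : contOneCocycles (subgroupRep ρ.toTopRep N))
    (h0 : galoisCohomology.res (ρ.coind N hN) E 1
      (shapiroLift ρ.toTopRep N hN hs hs1 (oneCocycleClass (subgroupRep ρ.toTopRep N) f)) = 0)
    (σ : absoluteGaloisGroup K) :
    ∃ a : M, ∀ k : N, σ * (k : absoluteGaloisGroup K) * σ⁻¹ ∈ (absGaloisRestrict K E).toMonoidHom.range →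
      ρ.toTopRep.ρ σ (f.1 k) = ρ.toTopRep.ρ (σ * (k : absoluteGaloisGroup K) * σ⁻¹) a - a := by
  rw [shapiroLift_oneCocycleClass] at h0
  have hres : galoisCohomology.res (ρ.coind N hN) E 1
      (oneCocycleClass (coindFin ρ.toTopRep N) (shapiroCocycle ρ.toTopRep N hN hs f)) =
      oneCocycleClass (DiscreteGaloisModule.toTopRep (GaloisRep.restrictField E (ρ.coind N hN)))
        (contOneCocycles.pullback (absGaloisRestrict K E) (X := (ρ.coind N hN).toTopRep)
          (Y := DiscreteGaloisModule.toTopRep (GaloisRep.restrictField E (ρ.coind N hN)))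
          (TopRep.ofHom ⟨ContinuousLinearMap.id ℤ (absoluteGaloisGroup K ⧸ N → M), fun _ => rfl⟩)
          (shapiroCocycle ρ.toTopRep N hN hs f)) :=
    map_oneCocycleClass _ _ _ _
  rw [hres] at h0
  obtain ⟨Φ₀, hΦ₀⟩ := (oneCocycleClass_eq_zero_iff _ _).mp h0
  refine exists_apply_conj_eq_of_shapiroCocycle_eq_on ρ.toTopRep N hN hs f (D := (absGaloisRestrict K E).toMonoidHom.range)
    (Φ₀ := Φ₀) ?_ σ
  rintro _ ⟨d, rfl⟩
  have h := hΦ₀ d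
  rw [contOneCocycles.pullback_apply, TopRep.hom_ofHom] at h
  exact h

end Res

/-! ## §3 The `hE` currency: `E[m]`-classes at a layer of a `ℤ_p`-extension, finite and infinite places -/

section Layer

variable {K : Type u} [Field K] [NumberField K] (W : WeierstrassCurve K) (m : ℤ)
  {p : ℕ} [Fact p.Prime] (κ : ZpExtension K p) (n : ℕ) [Fintype (absoluteGaloisGroup K ⧸ κ.layerSubgroup n)]
  {s : absoluteGaloisGroup K ⧸ κ.layerSubgroup n → absoluteGaloisGroup K}
  (hs : ∀ x : absoluteGaloisGroup K ⧸ κ.layerSubgroup n, (s x : absoluteGaloisGroup K ⧸ κ.layerSubgroup n) = x)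
  (hs1 : s ((1 : absoluteGaloisGroup K) : absoluteGaloisGroup K ⧸ κ.layerSubgroup n) = 1)

omit [NumberField K] in
/-- The common step of (E1b)/(E1c): from the vanishing of the restriction of `Sh c` to `Γ_E` to the vanishing of
`res_{Γ_n ∩ D_E} (conj_σ c)` for every `σ`, `D_E` the image of `Γ_E → Γ_K`. [cite: SerreGaloisCohomology1997, I §2.5]
[cite: NeukirchSchmidtWingberg2008, I §6 Prop. (1.6.4)] -/
theorem resOfLe_range_conjH1_eq_zero_of_res_shapiroLift_eq_zero (E : Type u) [Field E] [Algebra K E]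
    (c : W.torsionH1Over m (κ.layerSubgroup n))
    (h0 : galoisCohomology.res ((W.torsionGaloisModule m).coind (κ.layerSubgroup n) (κ.isOpen_layerSubgroup n)) E 1
      (shapiroLift (W.torsionGaloisModule m).toTopRep (κ.layerSubgroup n) (κ.isOpen_layerSubgroup n) hs hs1 c) = 0)
    (σ : absoluteGaloisGroup K) :
    resOfLe (WeierstrassCurve.geomTorsion W m)
        (inf_le_left : κ.layerSubgroup n ⊓ (absGaloisRestrict K E).toMonoidHom.range ≤ κ.layerSubgroup n)
      (conjH1 (κ.layerSubgroup n) (WeierstrassCurve.geomTorsion W m) σ c) = 0 := by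
  obtain ⟨z, rfl⟩ := oneCocycleClass_surjective (subgroupRep (W.torsionGaloisModule m).toTopRep (κ.layerSubgroup n)) c
  obtain ⟨a, ha⟩ := exists_apply_conj_eq_of_res_shapiroLift_eq_zero (W.torsionGaloisModule m) (κ.layerSubgroup n)
    (κ.isOpen_layerSubgroup n) hs hs1 E z h0 σ
  change resOfLe (WeierstrassCurve.geomTorsion W m) _
    (conjH1 (κ.layerSubgroup n) (WeierstrassCurve.geomTorsion W m) σ
      (oneCocycleClass (discreteTopRep (κ.layerSubgroup n) (WeierstrassCurve.geomTorsion W m)) z)) = 0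
  rw [CocycleCriteria.conjH1_oneCocycleClass_mem_ker_resOfLe_iff]
  refine ⟨a, fun x ↦ ?_⟩
  have hmem : σ * ((subgroupConj (κ.layerSubgroup n) σ (Subgroup.inclusion inf_le_left x) : κ.layerSubgroup n) :
      absoluteGaloisGroup K) * σ⁻¹ = (x : absoluteGaloisGroup K) := by
    rw [subgroupConj_apply_coe, Subgroup.coe_inclusion]; group
  have h := ha (subgroupConj (κ.layerSubgroup n) σ (Subgroup.inclusion inf_le_left x)) (by rw [hmem]; exact x.2.2)
  rw [hmem] at h
  exact h

/-- **(E1b) — FINITE places.** For `c ∈ H¹(Γ_n, E[m])` (`W.torsionH1Over m (κ.layerSubgroup n)`): if the localisation at the finite place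
`w` of the Shapiro lift `Sh c ∈ H¹(Γ_K, Maps(Γ_K ⧸ Γ_n, E[m]))` VANISHES, then for every `σ ∈ Γ_K` the conjugate class `conj_σ c` dies on
`Γ_n ∩ D_w` (`GreenbergSelmer.decomp w`, the decomposition group of the chosen prime above `w`) — i.e. `conj_σ c ∈ awayKer (κ.layerSubgroup n) _ w`.
[cite: SerreGaloisCohomology1997, I §2.5] [cite: Greenberg1989, §1 p. 98 (3)] -/
theorem resOfLe_decomp_conjH1_eq_zero_of_localization_shapiroLift_eq_zero (w : HeightOneSpectrum (𝓞 K))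
    (c : W.torsionH1Over m (κ.layerSubgroup n))
    (h0 : galoisCohomology.localization ((W.torsionGaloisModule m).coind (κ.layerSubgroup n) (κ.isOpen_layerSubgroup n)) (Sum.inr w) 1
      (shapiroLift (W.torsionGaloisModule m).toTopRep (κ.layerSubgroup n) (κ.isOpen_layerSubgroup n) hs hs1 c) = 0)
    (σ : absoluteGaloisGroup K) :
    resOfLe (WeierstrassCurve.geomTorsion W m) (inf_le_left : κ.layerSubgroup n ⊓ GreenbergSelmer.decomp w ≤ κ.layerSubgroup n)
      (conjH1 (κ.layerSubgroup n) (WeierstrassCurve.geomTorsion W m) σ c) = 0 :=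
  resOfLe_range_conjH1_eq_zero_of_res_shapiroLift_eq_zero W m κ n hs hs1 (NumberField.Place.Completion (Sum.inr w : NumberField.Place K))
    c h0 σ

/-- **(E1c) — INFINITE places.** The same at an infinite place `w` (`Sum.inl w`, `GreenbergSelmer.decompInf w`): if
`loc_w (Sh c) = 0` then `conj_σ c` dies on `Γ_n ∩ D_w` for every `σ` — i.e. `conj_σ c ∈ infKer (κ.layerSubgroup n) _ w`.
[cite: SerreGaloisCohomology1997, I §2.5] [cite: Greenberg1989, §1 p. 98 (3)] -/
theorem resOfLe_decompInf_conjH1_eq_zero_of_localization_shapiroLift_eq_zero (w : InfinitePlace K)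
    (c : W.torsionH1Over m (κ.layerSubgroup n))
    (h0 : galoisCohomology.localization ((W.torsionGaloisModule m).coind (κ.layerSubgroup n) (κ.isOpen_layerSubgroup n)) (Sum.inl w) 1
      (shapiroLift (W.torsionGaloisModule m).toTopRep (κ.layerSubgroup n) (κ.isOpen_layerSubgroup n) hs hs1 c) = 0)
    (σ : absoluteGaloisGroup K) :
    resOfLe (WeierstrassCurve.geomTorsion W m) (inf_le_left : κ.layerSubgroup n ⊓ GreenbergSelmer.decompInf w ≤ κ.layerSubgroup n)
      (conjH1 (κ.layerSubgroup n) (WeierstrassCurve.geomTorsion W m) σ c) = 0 :=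
  resOfLe_range_conjH1_eq_zero_of_res_shapiroLift_eq_zero W m κ n hs hs1 (NumberField.Place.Completion (Sum.inl w : NumberField.Place K))
    c h0 σ

end Layer

end SignedLowerOffTwo.PTDeep

end Summit.BirchSwinnertonDyer.BirchSwinnertonDyer.Theorems

end
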